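import Literature.NumberTheory.EllipticCurves.SwanConductorTorsionProofs
import Mathlib.LinearAlgebra.Matrix.GeneralLinearGroup.Card
import Mathlib.LinearAlgebra.Matrix.CharP
import HarnessLib

/-!
# At `p = 3`, irreducibility ALONE puts `−1` in the image: every subgroup of `GL₂(𝔽₃)` without a common
# eigenline contains `−1`; hence `E[3]` irreducible ⇒ some `σ ∈ Γ_F` acts on `E[3]` as `−1`

`Proofs`-style file (THEOREMS ONLY: no definition, no named fact, no instance, no notation), topic
`NumberTheory/EllipticCurves`. Cell `pub/bsd-print-x9`, seat `bsd-line-x10b-p2` LEAD g4 (row 10, p = 3), 2026-08-28.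

## What is proved

* `GLTwoZModThree.exists_common_eigenvector_of_neg_one_not_mem` — for a subgroup `H ≤ GL₂(𝔽₃)` with
  `−1 ∉ H` there is `v ≠ 0` in `𝔽₃²` which is an eigenvector of every element of `H` (a common eigenline).
  Proof (Serre 1972 §2-style subgroup analysis, done by cardinalities): `K = H ∩ SL₂(𝔽₃)` has no involution
  (`M² = 1`, `det M = 1` ⇒ `M = ±1`, a finite check on the four entries), so `#K` is odd; `#K ∣ #GL₂(𝔽₃) = 48`
  (Mathlib `Matrix.card_GL_field`) forces `#K ∈ {1, 3}`. If `#K = 3` then `K = ⟨u⟩ ◁ H` with `u` of order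
  `3`; `(u − 1)³ = u³ − 1 = 0` in characteristic `3`, so `u` fixes a vector `v ≠ 0`, its fixed space is the line
  `𝔽₃ v` (`u ≠ 1`), and `H` (which normalises `⟨u⟩`) preserves it. If `#K = 1` then `det` separates `H`,
  `H ⊆ {1, g}` with `g² = 1`, and `(g − 1)(g + 1) = 0` gives an eigenvector of `g`.
* `GLTwoZModThree.neg_one_mem_of_forall_exists_not_eigenvector` — contrapositive: no common eigenline ⇒
  `−1 ∈ H`.
* `exists_smul_eq_neg_of_irreducible_zmod_three` — abstract form: a group `Γ` acting additively on an
  `𝔽₃`-plane `V` (`finrank = 2`) with no `Γ`-stable additive subgroup other than `⊥`, `⊤` contains an element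
  acting as `−1` (transport to `GL₂(𝔽₃)` along a linear equivalence `V ≃ 𝔽₃²`).
* `WeierstrassCurve.exists_smul_eq_neg_of_hasIrreducibleModPGaloisRep_three` — for an elliptic curve `W`
  over any field `F` with `3 ≠ 0` in `F`: `W.HasIrreducibleModPGaloisRep 3 → ∃ σ : Γ_F, ∀ P ∈ E[3], σ • P = −P`
  (`dim_{𝔽₃} E[3] = 2`: tree `finrank_geomTorsion_eq_two`, Silverman AEC III.6.4(b)).

No hypothesis on the image beyond irreducibility (surjective, normaliser of a Cartan, exceptional are all
covered), none on reduction or ramification; specific to `p = 3` (at `p ≥ 5` an irreducible subgroup of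
`GL₂(𝔽_p)` need not contain `−1`).

## Why this file exists (cell `pub/bsd-print-x9`, rows 9/10)

Howard's abstract Kolyvagin-system hypothesis H.2 (Compositio 140 (2004), §1.3: `H¹(F(μ_{p^∞})/K, T̄) = 0`)
is being ported by seat `bsd-line-x10b-p1-w2` g5 in the form "ONE `σ ∈ Γ_K` acting on `E[p]` as a homothety
`a` with `p ∤ a − 1` ⇒ `H¹(Gal(L/K), E(L)[p^j]) = 0` up the division tower" (Lawson–Wuthrich 2016 Lemma 3 /
Cha 2005 Thm. 7), with the homothety left as an explicit hypothesis. On the X10b frames of the cell's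
residual letters (`p = 3`, `E[3]` irreducible over `K` — the `(irr_K)` binder) this file DISCHARGES that
hypothesis with `a = −1` (`3 ∤ −2`): `ρ̄_{E,3}(Γ_K) ∋ −1`. (Memo
`Summits/…/Cruxes/HowardContainmentAnyClassNumberX10b/P3PortCaveatVoid.md`, Prop. A (b).)
«beyond-print theorem»: no (finite group theory; Serre 1972 §2.4–2.6 lists the subgroups of `GL₂(𝔽₃)`).
BSD is NOT proved by this file; no summit statement is proved by this seat.

References: J.-P. Serre, Invent. Math. 15 (1972), §2.4–§2.6 [Serre1972]; T. Lawson, C. Wuthrich,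
"Vanishing of some Galois cohomology groups for elliptic curves" (2016), Lemmas 3–4 [LawsonWuthrich2016];
B. Howard, Compositio Math. 140 (2004), §1.3 H.2 [Howard2004HeegnerKolyvagin]; Silverman, AEC, III.6.4(b)
[SilvermanAEC2009].
-/

set_option autoImplicit false

open Matrix

namespace Literature.NumberTheory.EllipticCurves

/-! ### §1 Subgroups of `GL₂(𝔽₃)` avoiding `−1` have a common eigenline -/

namespace GLTwoZModThree

/-- `#GL₂(𝔽₃) = 48` (Mathlib `Matrix.card_GL_field`: `(9 − 1)(9 − 3)`). [folklore] -/
private theorem card_eq : Nat.card (GL (Fin 2) (ZMod 3)) = 48 := by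
  rw [Matrix.card_GL_field]
  norm_num [Fin.prod_univ_two, ZMod.card]

/-- The finite check behind "the only involution of `SL₂(𝔽₃)` is `−1`", on the four entries of a `2 × 2`
matrix over `𝔽₃`: `ad − bc = 1` and `M² = 1` force `M = ±1`. [cite: Serre1972, §2.4] -/
theorem entries_eq_of_det_eq_one_of_sq_eq_one :
    ∀ a b c d : ZMod 3, a * d - b * c = 1 →
      a * a + b * c = 1 → a * b + b * d = 0 → c * a + d * c = 0 → c * b + d * d = 1 →
      (a = 1 ∧ b = 0 ∧ c = 0 ∧ d = 1) ∨ (a = -1 ∧ b = 0 ∧ c = 0 ∧ d = -1) := by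
  decide

/-- **The only involutions of `SL₂(𝔽₃)` are `±1`**: a `2 × 2` matrix over `𝔽₃` with `det M = 1` and
`M² = 1` is `1` or `−1` (so `SL₂(𝔽₃) ≅ Q₈ ⋊ C₃` has the single involution `−1`). [cite: Serre1972, §2.4] -/
theorem eq_one_or_eq_neg_one_of_det_eq_one_of_mul_self_eq_one {M : Matrix (Fin 2) (Fin 2) (ZMod 3)}
    (hdet : M.det = 1) (hsq : M * M = 1) : M = 1 ∨ M = -1 := by
  obtain ⟨a, b, c, d, rfl⟩ : ∃ a b c d : ZMod 3, M = !![a, b; c, d] :=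
    ⟨M 0 0, M 0 1, M 1 0, M 1 1, Matrix.eta_fin_two M⟩
  rw [Matrix.det_fin_two_of] at hdet
  rw [Matrix.mul_fin_two, Matrix.one_fin_two] at hsq
  have h00 : a * a + b * c = 1 := by
    simpa using congrArg (fun N : Matrix (Fin 2) (Fin 2) (ZMod 3) => N 0 0) hsq
  have h01 : a * b + b * d = 0 := by
    simpa using congrArg (fun N : Matrix (Fin 2) (Fin 2) (ZMod 3) => N 0 1) hsq
  have h10 : c * a + d * c = 0 := by
    simpa using congrArg (fun N : Matrix (Fin 2) (Fin 2) (ZMod 3) => N 1 0) hsq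
  have h11 : c * b + d * d = 1 := by
    simpa using congrArg (fun N : Matrix (Fin 2) (Fin 2) (ZMod 3) => N 1 1) hsq
  rcases entries_eq_of_det_eq_one_of_sq_eq_one a b c d hdet h00 h01 h10 h11 with
    ⟨rfl, rfl, rfl, rfl⟩ | ⟨rfl, rfl, rfl, rfl⟩
  · left
    rw [← Matrix.one_fin_two]
  · right
    ext i j
    fin_cases i <;> fin_cases j <;> simp

/-- An involution of `GL₂(𝔽₃)` has an eigenvector with eigenvalue `±1`: `(g − 1)(g + 1) = g² − 1 = 0`, so
`det (g − 1) = 0` or `det (g + 1) = 0`. [folklore] -/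
private theorem exists_eigenvector_of_mul_self_eq_one {G : Matrix (Fin 2) (Fin 2) (ZMod 3)} (hsq : G * G = 1) :
    ∃ v : Fin 2 → ZMod 3, v ≠ 0 ∧ ∃ c : ZMod 3, G *ᵥ v = c • v := by
  have hprod : (G - 1) * (G + 1) = 0 := by
    rw [show (G - 1) * (G + 1) = G * G - 1 by noncomm_ring, hsq, sub_self]
  have hdet : (G - 1).det * (G + 1).det = 0 := by rw [← Matrix.det_mul, hprod, Matrix.det_zero]
  rcases mul_eq_zero.mp hdet with h | h
  · obtain ⟨v, hv, hGv⟩ := Matrix.exists_mulVec_eq_zero_iff.mpr h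
    refine ⟨v, hv, 1, ?_⟩
    rw [Matrix.sub_mulVec, Matrix.one_mulVec, sub_eq_zero] at hGv
    rw [hGv, one_smul]
  · obtain ⟨v, hv, hGv⟩ := Matrix.exists_mulVec_eq_zero_iff.mpr h
    refine ⟨v, hv, -1, ?_⟩
    rw [Matrix.add_mulVec, Matrix.one_mulVec, add_eq_zero_iff_eq_neg] at hGv
    rw [hGv, neg_one_smul]

/-- An element `u` of `GL₂(𝔽₃)` with `u³ = 1` fixes a non-zero vector: in characteristic `3`,
`(u − 1)³ = u³ − 1 = 0`, so `det (u − 1) = 0` (transvections are unipotent). [cite: Serre1972, §2.4] -/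
theorem exists_mulVec_eq_self_of_pow_three_eq_one {U : Matrix (Fin 2) (Fin 2) (ZMod 3)} (hU : U ^ 3 = 1) :
    ∃ v : Fin 2 → ZMod 3, v ≠ 0 ∧ U *ᵥ v = v := by
  have h3 : (U - 1) ^ 3 = 0 := by
    rw [sub_pow_char_of_commute (p := 3) (Commute.one_right U), hU, one_pow, sub_self]
  have hdet : (U - 1).det = 0 := by
    have h := congrArg Matrix.det h3
    rw [Matrix.det_pow, Matrix.det_zero] at h
    exact (pow_eq_zero_iff (n := 3) (by norm_num)).mp h
  obtain ⟨v, hv, hUv⟩ := Matrix.exists_mulVec_eq_zero_iff.mpr hdet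
  refine ⟨v, hv, ?_⟩
  rwa [Matrix.sub_mulVec, Matrix.one_mulVec, sub_eq_zero] at hUv

/-- The fixed space of a non-identity `u ∈ GL₂(𝔽₃)` fixing `v ≠ 0` is the LINE `𝔽₃ v`: every `u`-fixed
vector is a multiple of `v` (a proper non-zero subspace of the plane `𝔽₃²` is a line). [folklore] -/
private theorem exists_eq_smul_of_mulVec_eq_self {U : Matrix (Fin 2) (Fin 2) (ZMod 3)} (hU1 : U ≠ 1)
    {v : Fin 2 → ZMod 3} (hv : v ≠ 0) (hUv : U *ᵥ v = v) {w : Fin 2 → ZMod 3} (hUw : U *ᵥ w = w) :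
    ∃ c : ZMod 3, w = c • v := by
  -- the fixed space as the kernel of `toLin' (U - 1)`
  set F : Submodule (ZMod 3) (Fin 2 → ZMod 3) := LinearMap.ker (Matrix.toLin' (U - 1)) with hF
  have hmem : ∀ x : Fin 2 → ZMod 3, x ∈ F ↔ U *ᵥ x = x := by
    intro x
    rw [hF, LinearMap.mem_ker, Matrix.toLin'_apply, Matrix.sub_mulVec, Matrix.one_mulVec, sub_eq_zero]
  have hvF : v ∈ F := (hmem v).mpr hUv
  have hwF : w ∈ F := (hmem w).mpr hUw
  have hFtop : F ≠ ⊤ := by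
    intro htop
    apply hU1
    have hlin : Matrix.toLin' (U - 1) = 0 := LinearMap.ker_eq_top.mp (by rw [← hF, htop])
    have : U - 1 = 0 := by
      have h := congrArg LinearMap.toMatrix' hlin
      rwa [LinearMap.toMatrix'_toLin', map_zero] at h
    exact sub_eq_zero.mp this
  have hlt : Module.finrank (ZMod 3) F < 2 := by
    have h := Submodule.finrank_lt hFtop
    rwa [Module.finrank_fin_fun] at h
  have hspan_le : (ZMod 3) ∙ v ≤ F := (Submodule.span_singleton_le_iff_mem v F).mpr hvF
  have hspan_rank : Module.finrank (ZMod 3) ((ZMod 3) ∙ v) = 1 := finrank_span_singleton hv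
  have heq : (ZMod 3) ∙ v = F :=
    Submodule.eq_of_le_of_finrank_le hspan_le (by rw [hspan_rank]; omega)
  rw [← heq, Submodule.mem_span_singleton] at hwF
  obtain ⟨c, hc⟩ := hwF
  exact ⟨c, hc.symm⟩

/-- Every unit of `𝔽₃` squares to `1`. [folklore] -/
private theorem units_zmod_three_sq (x : (ZMod 3)ˣ) : x ^ 2 = 1 := by
  have key : ∀ y : ZMod 3, y ≠ 0 → y ^ 2 = 1 := by decide
  exact Units.ext (by rw [Units.val_pow_eq_pow_val, Units.val_one]; exact key _ x.ne_zero)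

/-- `𝔽₃ˣ = {1, −1}`: two units of `𝔽₃` different from `1` are equal. [folklore] -/
private theorem units_zmod_three_eq_of_ne_one {x y : (ZMod 3)ˣ} (hx : x ≠ 1) (hy : y ≠ 1) : x = y := by
  have key : ∀ a : ZMod 3, a ≠ 0 → a ≠ 1 → a = -1 := by decide
  have hx' : (x : ZMod 3) ≠ 1 := fun h ↦ hx (Units.ext (by rw [h, Units.val_one]))
  have hy' : (y : ZMod 3) ≠ 1 := fun h ↦ hy (Units.ext (by rw [h, Units.val_one]))
  exact Units.ext (by rw [key _ x.ne_zero hx', key _ y.ne_zero hy'])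

/-- **A subgroup of `GL₂(𝔽₃)` not containing `−1` has a common eigenvector** (equivalently fixes a line of
`𝔽₃²`): the subgroup analysis of the module docstring. [cite: Serre1972, §2.4–§2.6] -/
theorem exists_common_eigenvector_of_neg_one_not_mem (H : Subgroup (GL (Fin 2) (ZMod 3)))
    (hneg : (-1 : GL (Fin 2) (ZMod 3)) ∉ H) :
    ∃ v : Fin 2 → ZMod 3, v ≠ 0 ∧
      ∀ g ∈ H, ∃ c : ZMod 3, (g : Matrix (Fin 2) (Fin 2) (ZMod 3)) *ᵥ v = c • v := by
  classical
  -- `K = H ∩ SL₂(𝔽₃)`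
  set K : Subgroup (GL (Fin 2) (ZMod 3)) := H ⊓ (Matrix.GeneralLinearGroup.det).ker with hKdef
  have hmemK : ∀ g : GL (Fin 2) (ZMod 3), g ∈ K ↔ g ∈ H ∧ Matrix.GeneralLinearGroup.det g = 1 := by
    intro g
    rw [hKdef, Subgroup.mem_inf, MonoidHom.mem_ker]
  have hdetval : ∀ g : GL (Fin 2) (ZMod 3), Matrix.GeneralLinearGroup.det g = 1 →
      (g : Matrix (Fin 2) (Fin 2) (ZMod 3)).det = 1 := by
    intro g h
    have := congrArg Units.val h
    rwa [Matrix.GeneralLinearGroup.val_det_apply, Units.val_one] at this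
  -- `K` has no involution (the only involution of `SL₂(𝔽₃)` is `−1 ∉ H`)
  have hKinv : ∀ k ∈ K, k * k = 1 → k = 1 := by
    intro k hk hkk
    obtain ⟨hkH, hkdet⟩ := (hmemK k).mp hk
    have hsq : (k : Matrix (Fin 2) (Fin 2) (ZMod 3)) * k = 1 := by
      rw [← Units.val_mul, hkk, Units.val_one]
    rcases eq_one_or_eq_neg_one_of_det_eq_one_of_mul_self_eq_one (hdetval k hkdet) hsq with h | h
    · exact Units.ext h
    · exact absurd (by rwa [show k = -1 from Units.ext (by rw [h, Units.val_neg, Units.val_one])] at hkH) hneg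
  -- hence `#K` is odd …
  have hK2 : ¬ 2 ∣ Nat.card K := by
    intro h2
    obtain ⟨x, hx⟩ := exists_prime_orderOf_dvd_card' (G := K) 2 h2
    have hx2 : x ^ 2 = 1 := by
      have h := pow_orderOf_eq_one x
      rwa [hx] at h
    have hxx : (x : GL (Fin 2) (ZMod 3)) * x = 1 := by
      rw [← Subgroup.coe_mul, ← pow_two, hx2, Subgroup.coe_one]
    have h1 : (x : GL (Fin 2) (ZMod 3)) = 1 := hKinv x x.2 hxx
    have : orderOf x = 1 := by
      rw [orderOf_eq_one_iff]
      exact Subtype.ext h1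
    omega
  -- … and divides `48`, so `#K ∣ 3`
  have hKdvd : Nat.card K ∣ 3 := by
    have h48 : Nat.card K ∣ 3 * 16 := by
      rw [show (3 * 16 : ℕ) = Nat.card (GL (Fin 2) (ZMod 3)) from card_eq.symm]
      exact Subgroup.card_subgroup_dvd_card K
    have hcop : Nat.Coprime (Nat.card K) 16 := by
      have h2' : Nat.Coprime (Nat.card K) 2 :=
        ((Nat.Prime.coprime_iff_not_dvd Nat.prime_two).mpr hK2).symm
      simpa using h2'.pow_right 4
    exact hcop.dvd_of_dvd_mul_right h48
  -- squares of elements of `H` lie in `K`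
  have hsqK : ∀ g ∈ H, g * g ∈ K := by
    intro g hg
    refine (hmemK _).mpr ⟨H.mul_mem hg hg, ?_⟩
    rw [map_mul, ← pow_two, units_zmod_three_sq]
  rcases (Nat.dvd_prime Nat.prime_three).mp hKdvd with hK1 | hK3
  · -- `#K = 1`: `det` separates the elements of `H`, so `H ⊆ {1, g₀}` with `g₀² = 1`
    have hKbot : K = ⊥ := Subgroup.eq_bot_of_card_eq K hK1
    have hdet1 : ∀ g ∈ H, Matrix.GeneralLinearGroup.det g = 1 → g = 1 := by
      intro g hg hd
      have : g ∈ K := (hmemK g).mpr ⟨hg, hd⟩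
      rwa [hKbot, Subgroup.mem_bot] at this
    by_cases hbot : ∀ g ∈ H, g = 1
    · -- trivial subgroup: any non-zero vector works
      refine ⟨Pi.single 0 1, by simp, fun g hg ↦ ⟨1, ?_⟩⟩
      rw [hbot g hg, Units.val_one, Matrix.one_mulVec, one_smul]
    · push Not at hbot
      obtain ⟨g₀, hg₀H, hg₀1⟩ := hbot
      -- every element of `H` is `1` or `g₀`
      have hH : ∀ g ∈ H, g = 1 ∨ g = g₀ := by
        intro g hg
        by_cases hd : Matrix.GeneralLinearGroup.det g = 1
        · exact Or.inl (hdet1 g hg hd)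
        · right
          have hd₀ : Matrix.GeneralLinearGroup.det g₀ ≠ 1 := fun h ↦ hg₀1 (hdet1 g₀ hg₀H h)
          have heq : Matrix.GeneralLinearGroup.det g = Matrix.GeneralLinearGroup.det g₀ :=
            units_zmod_three_eq_of_ne_one hd hd₀
          have hq : g * g₀⁻¹ ∈ K := by
            refine (hmemK _).mpr ⟨H.mul_mem hg (H.inv_mem hg₀H), ?_⟩
            rw [map_mul, map_inv, heq, mul_inv_cancel]
          rw [hKbot, Subgroup.mem_bot, mul_inv_eq_one] at hq
          exact hq
      obtain ⟨v, hv, c, hc⟩ := exists_eigenvector_of_mul_self_eq_one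
        (G := (g₀ : Matrix (Fin 2) (Fin 2) (ZMod 3)))
        (by rw [← Units.val_mul, (by simpa [hKbot] using hsqK g₀ hg₀H : g₀ * g₀ = 1), Units.val_one])
      refine ⟨v, hv, fun g hg ↦ ?_⟩
      rcases hH g hg with rfl | rfl
      · exact ⟨1, by rw [Units.val_one, Matrix.one_mulVec, one_smul]⟩
      · exact ⟨c, hc⟩
  · -- `#K = 3`: `K = ⟨u⟩` with `u³ = 1`, `u ≠ 1`, normal in `H`; `H` fixes the line of `u`-fixed vectors
    obtain ⟨x, hx⟩ := exists_prime_orderOf_dvd_card' (G := K) 3 (dvd_of_eq hK3.symm)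
    set u : GL (Fin 2) (ZMod 3) := (x : GL (Fin 2) (ZMod 3)) with hudef
    have huK : u ∈ K := x.2
    have hx3 : x ^ 3 = 1 := by
      have h := pow_orderOf_eq_one x
      rwa [hx] at h
    have hu3 : u ^ 3 = 1 := by
      rw [hudef, ← Subgroup.coe_pow, hx3, Subgroup.coe_one]
    have hu1 : u ≠ 1 := by
      intro h
      have : orderOf x = 1 := by
        rw [orderOf_eq_one_iff]
        exact Subtype.ext h
      omega
    -- every element of `K` is a power of `u`
    have hKpow : ∀ k ∈ K, ∃ i : ℕ, u ^ i = k := by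
      intro k hk
      have hzle : Subgroup.zpowers u ≤ K := (Subgroup.zpowers_le (G := GL (Fin 2) (ZMod 3))).mpr huK
      have hzcard : Nat.card (Subgroup.zpowers u) = 3 := by
        rw [Nat.card_zpowers, hudef, Subgroup.orderOf_coe, hx]
      have hzeq : Subgroup.zpowers u = K := Subgroup.eq_of_le_of_card_ge hzle (by omega)
      have hk' : k ∈ Subgroup.zpowers u := hzeq ▸ hk
      have hfin : IsOfFinOrder u := isOfFinOrder_iff_pow_eq_one.mpr ⟨3, by norm_num, hu3⟩
      exact (Submonoid.mem_powers_iff _ _).mp (hfin.mem_powers_iff_mem_zpowers.mpr hk')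
    -- a non-zero `u`-fixed vector
    have hU3 : (u : Matrix (Fin 2) (Fin 2) (ZMod 3)) ^ 3 = 1 := by
      rw [← Units.val_pow_eq_pow_val, hu3, Units.val_one]
    have hU1 : (u : Matrix (Fin 2) (Fin 2) (ZMod 3)) ≠ 1 := fun h ↦ hu1 (Units.ext h)
    obtain ⟨v, hv, hUv⟩ := exists_mulVec_eq_self_of_pow_three_eq_one hU3
    refine ⟨v, hv, fun g hg ↦ ?_⟩
    -- `g⁻¹ u g ∈ K` is a power of `u`, hence fixes `v`; so `u (g v) = g v`, and `g v` is on the line `𝔽₃ v`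
    have hconj : g⁻¹ * u * g ∈ K := by
      refine (hmemK _).mpr ⟨H.mul_mem (H.mul_mem (H.inv_mem hg) ((hmemK u).mp huK).1) hg, ?_⟩
      rw [map_mul, map_mul, map_inv, ((hmemK u).mp huK).2, mul_one, inv_mul_cancel]
    obtain ⟨i, hi⟩ := hKpow _ hconj
    have hpow_fix : ∀ n : ℕ, ((u : Matrix (Fin 2) (Fin 2) (ZMod 3)) ^ n) *ᵥ v = v := by
      intro n
      induction n with
      | zero => rw [pow_zero, Matrix.one_mulVec]
      | succ n ih => rw [pow_succ, ← Matrix.mulVec_mulVec, hUv, ih]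
    have hug : ((u : GL (Fin 2) (ZMod 3)) : Matrix (Fin 2) (Fin 2) (ZMod 3)) *
          ((g : GL (Fin 2) (ZMod 3)) : Matrix (Fin 2) (Fin 2) (ZMod 3)) =
        ((g : GL (Fin 2) (ZMod 3)) : Matrix (Fin 2) (Fin 2) (ZMod 3)) *
          ((g⁻¹ * u * g : GL (Fin 2) (ZMod 3)) : Matrix (Fin 2) (Fin 2) (ZMod 3)) := by
      rw [← Units.val_mul, ← Units.val_mul]
      congr 1
      group
    have hfix : (u : Matrix (Fin 2) (Fin 2) (ZMod 3)) *ᵥ ((g : Matrix (Fin 2) (Fin 2) (ZMod 3)) *ᵥ v) =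
        (g : Matrix (Fin 2) (Fin 2) (ZMod 3)) *ᵥ v := by
      rw [Matrix.mulVec_mulVec, hug, ← hi, ← Matrix.mulVec_mulVec, Units.val_pow_eq_pow_val, hpow_fix]
    exact exists_eq_smul_of_mulVec_eq_self hU1 hv hUv hfix

/-- **Every subgroup of `GL₂(𝔽₃)` acting on `𝔽₃²` without a common eigenline contains `−1`** (contrapositive
of `exists_common_eigenvector_of_neg_one_not_mem`). In particular every irreducible subgroup of `GL₂(𝔽₃)` —
`SL₂(𝔽₃)`, `GL₂(𝔽₃)`, the normalisers of split / non-split Cartan subgroups and their irreducible subgroups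
`C₄, C₈, Q₈, D₄, SD₁₆` — contains the central involution `−1`. [cite: Serre1972, §2.4–§2.6] -/
theorem neg_one_mem_of_forall_exists_not_eigenvector (H : Subgroup (GL (Fin 2) (ZMod 3)))
    (hirr : ∀ v : Fin 2 → ZMod 3, v ≠ 0 →
      ∃ g ∈ H, ∀ c : ZMod 3, (g : Matrix (Fin 2) (Fin 2) (ZMod 3)) *ᵥ v ≠ c • v) :
    (-1 : GL (Fin 2) (ZMod 3)) ∈ H := by
  by_contra hneg
  obtain ⟨v, hv, hev⟩ := exists_common_eigenvector_of_neg_one_not_mem H hneg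
  obtain ⟨g, hg, hng⟩ := hirr v hv
  obtain ⟨c, hc⟩ := hev g hg
  exact hng c hc

end GLTwoZModThree

/-! ### §2 Abstract form: a group acting on an `𝔽₃`-plane with no stable line has an element acting as `−1` -/

/-- **Irreducible action on an `𝔽₃`-plane ⇒ some element acts as `−1`.** Let a group `Γ` act on an additive
group `V` which is a `2`-dimensional `𝔽₃`-vector space (`Module (ZMod 3) V`, `finrank = 2`), by additive maps
(`DistribMulAction`). If the only `Γ`-stable additive subgroups of `V` are `⊥` and `⊤`, then some `γ ∈ Γ` acts
on `V` as `x ↦ −x`. (Transport to `GL₂(𝔽₃)` along `V ≃ₗ 𝔽₃²` and §1.) [cite: Serre1972, §2.4–§2.6] -/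
theorem exists_smul_eq_neg_of_irreducible_zmod_three {Γ V : Type*} [Group Γ] [AddCommGroup V]
    [Module (ZMod 3) V] [DistribMulAction Γ V] (hV : Module.finrank (ZMod 3) V = 2)
    (hirr : ∀ A : AddSubgroup V, (∀ (γ : Γ), ∀ x ∈ A, γ • x ∈ A) → A = ⊥ ∨ A = ⊤) :
    ∃ γ : Γ, ∀ x : V, γ • x = -x := by
  classical
  haveI : Module.Finite (ZMod 3) V := Module.finite_of_finrank_eq_succ hV
  -- a linear equivalence with the coordinate plane
  let e : V ≃ₗ[ZMod 3] (Fin 2 → ZMod 3) :=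
    LinearEquiv.ofFinrankEq V (Fin 2 → ZMod 3) (by rw [hV, Module.finrank_fin_fun])
  -- the action of `γ` as an `𝔽₃`-linear map of `V` and of the coordinate plane, and its matrix
  let f : Γ → V →ₗ[ZMod 3] V := fun γ ↦ (DistribSMul.toAddMonoidHom V γ).toZModLinearMap 3
  have hf : ∀ (γ : Γ) (x : V), f γ x = γ • x := fun _ _ ↦ rfl
  let L : Γ → (Fin 2 → ZMod 3) →ₗ[ZMod 3] (Fin 2 → ZMod 3) := fun γ ↦
    e.toLinearMap ∘ₗ f γ ∘ₗ e.symm.toLinearMap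
  have hL : ∀ (γ : Γ) (w : Fin 2 → ZMod 3), L γ w = e (γ • e.symm w) := fun γ w ↦ rfl
  have hLmul : ∀ γ δ : Γ, L (γ * δ) = L γ ∘ₗ L δ := by
    intro γ δ
    refine LinearMap.ext (fun w ↦ ?_)
    change L (γ * δ) w = L γ (L δ w)
    rw [hL, hL, hL, LinearEquiv.symm_apply_apply, mul_smul]
  have hLone : L 1 = LinearMap.id := by
    refine LinearMap.ext (fun w ↦ ?_)
    change L 1 w = w
    rw [hL, one_smul, LinearEquiv.apply_symm_apply]
  let M : Γ → Matrix (Fin 2) (Fin 2) (ZMod 3) := fun γ ↦ LinearMap.toMatrix' (L γ)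
  have hMmul : ∀ γ δ : Γ, M (γ * δ) = M γ * M δ := by
    intro γ δ
    change LinearMap.toMatrix' (L (γ * δ)) = LinearMap.toMatrix' (L γ) * LinearMap.toMatrix' (L δ)
    rw [hLmul, LinearMap.toMatrix'_comp]
  have hMone : M 1 = 1 := by
    change LinearMap.toMatrix' (L 1) = 1
    rw [hLone, LinearMap.toMatrix'_id]
  have hMvec : ∀ (γ : Γ) (w : Fin 2 → ZMod 3), M γ *ᵥ w = e (γ • e.symm w) := by
    intro γ w
    change LinearMap.toMatrix' (L γ) *ᵥ w = _
    rw [LinearMap.toMatrix'_mulVec, hL]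
  -- the homomorphism `Γ → GL₂(𝔽₃)`
  let u : Γ → GL (Fin 2) (ZMod 3) := fun γ ↦
    ⟨M γ, M γ⁻¹, by rw [← hMmul, mul_inv_cancel, hMone], by rw [← hMmul, inv_mul_cancel, hMone]⟩
  have hu : ∀ γ : Γ, ((u γ : GL (Fin 2) (ZMod 3)) : Matrix (Fin 2) (Fin 2) (ZMod 3)) = M γ := fun _ ↦ rfl
  let ψ : Γ →* GL (Fin 2) (ZMod 3) :=
    { toFun := u
      map_one' := Units.ext (by rw [hu, hMone, Units.val_one])
      map_mul' := fun γ δ ↦ Units.ext (by rw [Units.val_mul, hu, hu, hu, hMmul]) }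
  have hψ : ∀ γ : Γ, ((ψ γ : GL (Fin 2) (ZMod 3)) : Matrix (Fin 2) (Fin 2) (ZMod 3)) = M γ := fun _ ↦ rfl
  -- no common eigenline for the image (irreducibility transported along `e`)
  have hirr' : ∀ v : Fin 2 → ZMod 3, v ≠ 0 →
      ∃ g ∈ ψ.range, ∀ c : ZMod 3, (g : Matrix (Fin 2) (Fin 2) (ZMod 3)) *ᵥ v ≠ c • v := by
    intro v hv
    by_contra hall
    push Not at hall
    have hsv : e.symm v ≠ 0 := by
      intro h
      exact hv (by simpa using congrArg e h)
    -- then the line through `e.symm v` is `Γ`-stable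
    let A : AddSubgroup V := ((ZMod 3) ∙ e.symm v).toAddSubgroup
    have hA : ∀ (γ : Γ), ∀ x ∈ A, γ • x ∈ A := by
      intro γ x hx
      have hx' : x ∈ (ZMod 3) ∙ e.symm v := hx
      obtain ⟨a, rfl⟩ := Submodule.mem_span_singleton.mp hx'
      obtain ⟨c, hc⟩ := hall (ψ γ) ⟨γ, rfl⟩
      rw [hψ] at hc
      have hγv : γ • e.symm v = c • e.symm v := by
        apply e.injective
        rw [← hMvec, hc, map_smul, LinearEquiv.apply_symm_apply]
      have hcomm : γ • (a • e.symm v) = a • (γ • e.symm v) := by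
        rw [← hf, ← hf, map_smul]
      change γ • (a • e.symm v) ∈ (ZMod 3) ∙ e.symm v
      rw [hcomm, hγv, smul_smul]
      exact Submodule.smul_mem _ _ (Submodule.mem_span_singleton_self _)
    rcases hirr A hA with hbot | htop
    · have hmem : e.symm v ∈ A := Submodule.mem_span_singleton_self _
      rw [hbot, AddSubgroup.mem_bot] at hmem
      exact hsv hmem
    · -- the line is not all of `V`: `finrank 1 < 2`
      have h1 : Module.finrank (ZMod 3) ((ZMod 3) ∙ e.symm v) = 1 := finrank_span_singleton hsv
      have hspan_top : ((ZMod 3) ∙ e.symm v) = ⊤ := Submodule.toAddSubgroup_eq_top.mp htop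
      rw [hspan_top, finrank_top, hV] at h1
      omega
  obtain ⟨γ, hγ⟩ : ∃ γ : Γ, ψ γ = -1 :=
    GLTwoZModThree.neg_one_mem_of_forall_exists_not_eigenvector ψ.range hirr'
  refine ⟨γ, fun x ↦ ?_⟩
  have hMγ : M γ = -1 := by
    have h := congrArg (fun g : GL (Fin 2) (ZMod 3) ↦ (g : Matrix (Fin 2) (Fin 2) (ZMod 3))) hγ
    simp only [hψ, Units.val_neg, Units.val_one] at h
    exact h
  have h := hMvec γ (e x)
  rw [hMγ, Matrix.neg_mulVec, Matrix.one_mulVec, LinearEquiv.symm_apply_apply] at h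
  apply e.injective
  rw [map_neg]
  exact h.symm

/-! ### §3 Elliptic curves: `E[3]` irreducible ⇒ some `σ ∈ Γ_F` acts on `E[3]` as `−1` -/

end Literature.NumberTheory.EllipticCurves

namespace WeierstrassCurve

open Literature.NumberTheory.EllipticCurves

/-- **`E[3]` irreducible ⇒ `−1 ∈ ρ̄_{E,3}(Γ_F)`.** For an elliptic curve `W` over a field `F` with `3 ≠ 0`
in `F`: if `E[3] = E(F̄)[3]` is an irreducible `Γ_F`-module (`W.HasIrreducibleModPGaloisRep 3`), then some
`σ ∈ Γ_F = Gal(F̄/F)` acts on `E[3]` as `P ↦ −P`. Specific to `p = 3`: irreducibility alone suffices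
(every irreducible subgroup of `GL₂(𝔽₃)` contains `−1`); `dim_{𝔽₃} E[3] = 2` is the tree's
`finrank_geomTorsion_eq_two` (Silverman AEC III.6.4(b)). This is the homothety input (`a = −1`, `3 ∤ a − 1`)
of the division-tower `H¹`-vanishing (Howard 2004 H.2 / Lawson–Wuthrich 2016 Lemma 3) on every X10b frame of
cell `pub/bsd-print-x9` (there `F = K` imaginary quadratic and `(irr_K)` is a binder of the residual letters).
[cite: Serre1972, §2.4–§2.6] [cite: SilvermanAEC2009, Cor. III.6.4(b)] -/
theorem exists_smul_eq_neg_of_hasIrreducibleModPGaloisRep_three {F : Type*} [Field F]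
    (W : WeierstrassCurve F) [W.IsElliptic] (h3 : (3 : F) ≠ 0) (hirr : W.HasIrreducibleModPGaloisRep 3) :
    ∃ σ : Field.absoluteGaloisGroup F, ∀ P : geomTorsion W ((3 : ℕ) : ℤ), σ • P = -P := by
  letI : Module (ZMod 3) (geomTorsion W ((3 : ℕ) : ℤ)) := AddSubgroup.torsionBy.zmodModule
  have hV : Module.finrank (ZMod 3) (geomTorsion W ((3 : ℕ) : ℤ)) = 2 :=
    W.finrank_geomTorsion_eq_two 3 (by exact_mod_cast h3)
  exact exists_smul_eq_neg_of_irreducible_zmod_three (Γ := Field.absoluteGaloisGroup F) hV hirr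

end WeierstrassCurve
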